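import Literature.AnabelianGeometry.EtaleTheta.SettingModelTateInversion
import HarnessLib

/-!
# The STAGE-2 («Tate shear») model of the [EtTh] §1 root: the DECK RELATION of the affine action in level
# coordinates — `a⁻¹·σ(a) ≡ b^{k}·c^{−m}` — and the SIGN of the Tate instance (proof-only kernel certificate)

Mochizuki, *The étale theta function …*, Publ. RIMS **45** (2009) [EtTh], Prop. 1.5 (iii), PRIMS PDF p. 23
[cite: MochizukiEtTh2009, Prop 1.5 (iii) p.23]: a lift of `a ∈ Z ≅ Π^tp_X/Π^tp_Y` acts on the lifted theta class by
"`η̈^Θ ↦ η̈^Θ − 2a·log(Ü) − (a²/2)·log(q_X) + log(O^×_K̈)`".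

Cell abc-iut, layer L2, R78 cluster STAGE 2 (integrator abc-iut-L6-d6), seat abc-iut-w5-d249 (gen 5).  PROOF-ONLY (0
definitions), over this seat's F4q/F4q-ι (`SettingModelTateSemidirect`, `SettingModelTateInversion`), abc-iut-L2-t6's F2c
(`affTwist₃`, `innB`, `shear`), abc-iut-w5-d024's F2 (`hHat_bPow`, `hHat_twist`) and abc-iut-L2-t1's root chain (`hHat`,
`Heis`, `gfpOf`) — consumed BY NAME, nothing restated.

WHY.  abc-iut-L2-t12's kernel normal form (`ThetaDeckConjugation.conj_pow_normalForm_tate`, p430662) says: in any group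
with `a⁻¹ b a = c⁻¹ b`, `c` central and the TWISTED Galois relation `a⁻¹ g a = b^k c^m g`, the printed `Z`-action law
of Prop. 1.5 (iii) is produced by `(k, m) = (2κ, −κ)` (`κ` the Kummer class of `q̈`).  The stage-2 model realises the
Galois element `g = inr σ` acting on `Γ` by `θ_σ = Inn(b^{m_b}) ∘ shear(k_b) ∘ θ_{χ σ}` with `(m_b, k_b) = (κ_p(σ)^i,
κ_p(σ)^j)` (`tatePairHom p i j`).  THIS FILE computes, IN THE KERNEL, which `(k, m)` of L2-t12's relation a given
`(m_b, k_b)` realises — on every Heisenberg level `ĥ_N : F̂₂ → Heis(ℤ/N)` (where `c = ⁅a,b⁆ ↦ (0,0,1)`):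

* **`hHat_eta_inv_mul_affTwist₃_eta`**: `ĥ_N((η a)⁻¹ · affTwist₃ ⟨(m_b, k_b), α⟩ (η a)) = (0, k_b mod N, −(m_b mod N))`,
  i.e. `a⁻¹·σ(a) ≡ b^{k_b} · c^{−m_b}` — the `c`-EXPONENT IS MINUS THE INNER `b`-POWER EXPONENT
  (`Inn(b^t)(a) = b^t a b^{−t} ≡ a·c^{−t}`);
* in `Π^tp_X = Γ ⋊ G_{ℚ_p}`: `inl_inv_mul_inr_mul_inl` (`(inl a)⁻¹ · inr σ · inl a = inl (a⁻¹·σ(a)) · inr σ`, the shape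
  of L2-t12's `a⁻¹ g a = (…) g`) and **`hHat_deckDefectχq`**:
  `ĥ_N (pr₁ ((η a,1)⁻¹ · σ·(η a,1))) = (0, κ_p(σ)^j mod N, −(κ_p(σ)^i mod N))`;
* CONSEQUENCE (sign of the Tate instance): L2-t12's `(k, m) = (2κ_p, −κ_p)` is realised by **`(i, j) = (1, 2)`** —
  inner exponent `m_b = +κ_p`, shear `k_b = κ_p²` — and the opposite deck orientation by `(−1, −2)`; NOT by `(−1, 2)`.
  Independent cross-check from F4q-ι: the stage-2 inversion FIXES the canonical Galois section exactly on the line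
  `j = 2i` (`invDefect_tatePairHom_of_eq : invDefect (tatePairHom p i (i + i) σ) = 1`, `inversionχq_inr_of_eq`), as the
  geometric inversion `[−1]` of the punctured Tate curve (defined over `K`) must.
Every statement holds for all `(i, j)`; nothing here CHOOSES the instance — it records what each choice means.
SEMI-SYNTHETIC MODEL, CONSISTENCY EVIDENCE ONLY; nothing of [EtTh] asserted; no side taken on [IUTchIII] Cor. 3.12; typed ≠
proved.
-/

noncomputable section

namespace Literature.AnabelianGeometry.EtaleTheta.SettingModel

open Literature.AnabelianGeometry.SemiGraphs
open Function

/-! ## §1. The deck relation of the affine action on the Heisenberg levels -/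

/-- **`a⁻¹ · σ(a) ≡ b^{k} · c^{−m}` on every level**: for `g = ⟨(m, k), α⟩`,
`ĥ_N ((η a)⁻¹ · affTwist₃ g (η a)) = (0, k mod N, −(m mod N))` in `Heis(ℤ/N)` (`c = ⁅a,b⁆ ↦ (0,0,1)`): the `y`-coordinate
is the SHEAR exponent, the `z`-coordinate is MINUS the INNER exponent. [cite: MochizukiEtTh2009, Prop 1.5 (iii) p.23] -/
theorem hHat_eta_inv_mul_affTwist₃_eta (N : ℕ+) (g : (ZH × ZH) ⋊[diagAut] MulAut ZH) :
    hHat N ((eta (FreeGroup.of 0))⁻¹ * affTwist₃ g (eta (FreeGroup.of 0))) =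
      ⟨0, Multiplicative.toAdd (ZHatLevel.level N g.left.2), -Multiplicative.toAdd (ZHatLevel.level N g.left.1)⟩ := by
  rw [affTwist₃_eta_of_zero, map_mul, map_inv, map_mul, map_mul, map_inv, map_mul, hHat_bPow, hHat_bPow, hHat_eta,
    heisHom_of_zero]
  ext <;> simp

/-- The same for the model's pair `(m, k) = (κ_p(σ)^i, κ_p(σ)^j)`:
`ĥ_N ((η a)⁻¹ · actHatχq σ (η a)) = (0, κ_p(σ)^j mod N, −(κ_p(σ)^i mod N))`. [cite: MochizukiEtTh2009, Prop 1.5 (iii) p.23] -/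
theorem hHat_eta_inv_mul_actHatχq_eta (p : ℕ) [Fact p.Prime] (i j : ℤ) (N : ℕ+) (σ : GQp p) :
    hHat N ((eta (FreeGroup.of 0))⁻¹ * actHatχq p i j σ (eta (FreeGroup.of 0))) =
      ⟨0, Multiplicative.toAdd (ZHatLevel.level N (kappaP p σ ^ j)),
        -Multiplicative.toAdd (ZHatLevel.level N (kappaP p σ ^ i))⟩ :=
  hHat_eta_inv_mul_affTwist₃_eta N _

/-! ## §2. The deck conjugation of the Galois section in `Γ ⋊ G` -/

section Deck

variable {G : Type*} [Group G] (φ : G →* MulAut Gfp)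

/-- **The shape of L2-t12's twisted relation in a semidirect product**: conjugating the Galois section by an element
of the normal factor, `(inl γ)⁻¹ · inr g · inl γ = inl (γ⁻¹ · φ_g γ) · inr g`. [cite: MochizukiEtTh2009, Prop 1.5 (iii) p.23] -/
theorem inl_inv_mul_inr_mul_inl (γ : Gfp) (g : G) :
    (SemidirectProduct.inl γ : Gfp ⋊[φ] G)⁻¹ * SemidirectProduct.inr g * SemidirectProduct.inl γ =
      SemidirectProduct.inl (γ⁻¹ * φ g γ) * SemidirectProduct.inr g := by
  refine SemidirectProduct.ext ?_ ?_
  · simp [SemidirectProduct.mul_left]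
  · simp [SemidirectProduct.mul_right]

end Deck

variable (p : ℕ) [Fact p.Prime] (i j : ℤ)

/-- The deck generator of the model: `a := (η a, 1) ∈ Γ` (degree `1`). [cite: MochizukiEtTh2009, Prop 1.5 (iii) p.23] -/
theorem gfpFst_gfpOf_zero : gfpFst (gfpOf (FreeGroup.of 0)) = eta (FreeGroup.of 0) := rfl

/-- **The deck relation of the stage-2 model in level coordinates**: for the deck generator `a = (η a, 1)` and the
Galois section `σ ↦ inr σ` of `Π^tp_X = Γ ⋊_{actχq} G_{ℚ_p}`, the `Γ`-defect `a⁻¹·σ(a)` of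
`(inl a)⁻¹ · inr σ · inl a = inl (a⁻¹·σ(a)) · inr σ` has Heisenberg level
`(0, κ_p(σ)^j mod N, −(κ_p(σ)^i mod N))` — L2-t12's `(k, m)` at level `N` is `(κ_p^j, −κ_p^i)`; the Tate normal form
`(2κ_p, −κ_p)` is the instance `(i, j) = (1, 2)`. [cite: MochizukiEtTh2009, Prop 1.5 (iii) p.23] -/
theorem hHat_deckDefectχq (N : ℕ+) (σ : GQp p) :
    hHat N (gfpFst ((gfpOf (FreeGroup.of 0))⁻¹ * actχq p i j σ (gfpOf (FreeGroup.of 0)))) =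
      ⟨0, Multiplicative.toAdd (ZHatLevel.level N (kappaP p σ ^ j)),
        -Multiplicative.toAdd (ZHatLevel.level N (kappaP p σ ^ i))⟩ := by
  rw [map_mul, map_inv, gfpFst_actχq, gfpFst_gfpOf_zero]
  exact hHat_eta_inv_mul_actHatχq_eta p i j N σ

/-- The deck conjugation of the Galois section in `Π^tp_X` (stage 2), L2-t12's shape `a⁻¹ g a = (defect)·g`.
[cite: MochizukiEtTh2009, Prop 1.5 (iii) p.23] -/
theorem deckConjχq (σ : GQp p) :
    (SemidirectProduct.inl (gfpOf (FreeGroup.of 0)) : PiTpχq p i j)⁻¹ * SemidirectProduct.inr σ *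
        SemidirectProduct.inl (gfpOf (FreeGroup.of 0)) =
      SemidirectProduct.inl ((gfpOf (FreeGroup.of 0))⁻¹ * actχq p i j σ (gfpOf (FreeGroup.of 0))) *
        SemidirectProduct.inr σ :=
  inl_inv_mul_inr_mul_inl (actχq p i j) _ σ

/-! ## §3. Cross-check from the inversion: section-fixing exactly on the line `j = 2i` -/

/-- On the line `j = 2i` the inversion defect vanishes: `invDefect (tatePairHom p i (i + i) σ) = 1`.
[cite: MochizukiEtTh2009, §2 p.36] -/
theorem invDefect_tatePairHom_of_eq (σ : GQp p) : invDefect (tatePairHom p i (i + i) σ) = 1 := by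
  rw [invDefect_tatePairHom]
  have h : (-i + -i + (i + i) : ℤ) = 0 := by ring
  rw [h, zpow_zero]

/-- **On the line `j = 2i` the stage-2 inversion FIXES the canonical Galois section**: `ι (inr σ) = inr σ` (as the
geometric inversion of the punctured Tate curve, defined over `K`, must). [cite: Mochizuki2012, Rmk 1.4.1 (ii) p.28] -/
theorem inversionχq_inr_of_eq (σ : GQp p) :
    inversionχq p i (i + i) (SemidirectProduct.inr σ) = SemidirectProduct.inr σ := by
  rw [inversionχq_apply, tateInversion_inr, invDefect_tatePairHom_of_eq, map_one, map_one, one_mul]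

/-- In particular at `(i, j) = (1, 2)`: `invDefect (tatePairHom p 1 2 σ) = 1`. [cite: MochizukiEtTh2009, §2 p.36] -/
theorem invDefect_tatePairHom_one_two (σ : GQp p) : invDefect (tatePairHom p 1 2 σ) = 1 :=
  invDefect_tatePairHom_of_eq p 1 σ

/-- … whereas at `(i, j) = (−1, 2)` the defect is `κ_p(σ)^4` (the section is moved by `b^{4κ_p}`).
[cite: MochizukiEtTh2009, §2 p.36] -/
theorem invDefect_tatePairHom_neg_one_two (σ : GQp p) : invDefect (tatePairHom p (-1) 2 σ) = kappaP p σ ^ (4 : ℤ) := by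
  rw [invDefect_tatePairHom]
  norm_num

end Literature.AnabelianGeometry.EtaleTheta.SettingModel

end
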